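import Literature.GroupTheory.CombinatorialGroupTheory.AmalgamReducedWords
import HarnessLib

/-!
# The ping-pong criterion for extending a pair of homomorphisms along two subgroups
# (a homomorphism out of an image of an amalgam `G_false *_H G_true` is well defined as soon as
# reduced words act by ping-pong)

Topic `Literature/GroupTheory/CombinatorialGroupTheory`; theorems only, over Mathlib's amalgamated
product `Monoid.PushoutI φ` with two factors (`ι = Bool`), continuing `AmalgamReducedWords.lean`.

Setting.  `φ b : H →* G b` (`b : Bool`) injective, `ψ : PushoutI φ →* Δ` a homomorphism to a group `Δ`
(think: `G false, G true ≤ Δ` two subgroups with intersection `H`, `ψ` the tautological map), a subset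
`X₁ ⊆ Δ` and a "height" `N : Δ → β` (`β` a preorder).  The **ping-pong hypotheses** (Lyndon–Schupp
Ch. III §12 Prop. 12.4 «ping-pong lemma» adapted to an amalgam; Serre, *Trees*, I §4.1, proof of
Thm. 6 / II §1.4: the two half-trees cut out by the edge with stabiliser `H`):

* (h0) the factor `G false` misses `X₁` and has the height of `1`;
* (hL) a letter of `G false` off `H` maps `X₁` OUT of `X₁`, preserving the height;
* (hR) a letter of `G true` off `H` maps the complement of `X₁` INTO `X₁`, raising the height;
* (hB) `H` preserves `X₁` and the height.

Conclusion (`lift_eq_one_of_pingPong`): for every pair of homomorphisms `f b : G b →* M` agreeing on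
`H`, the induced `PushoutI.lift f` kills `ker ψ` — i.e. it FACTORS THROUGH the image `ψ(PushoutI φ) ≤ Δ`
(`exists_extension_of_pingPong`: a function `Φ : Δ → M`, multiplicative on `ψ.range`, with
`Φ ∘ ψ ∘ of b = f b`).  (Under the same hypotheses `ψ` is in fact injective, i.e. `ψ.range` IS the
amalgam — the usual ping-pong conclusion; only the factorisation is recorded here, which is what a
consumer extending characters needs.)  The proof is the standard one: write an element of the amalgam
as `c · g₁ ⋯ gₙ` with a reduced word `g₁ ⋯ gₙ` (`Amalgam.exists_reduced_eq`) and run the ping-pong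
along the word from the right: a reduced word containing a letter of `G true` strictly raises the height
of `1`, so an element of `ker ψ` is `c · g` with `g ∈ G false`, on which `lift f = f false` is a
homomorphism.

Consumer: `Literature/NumberTheory/EllipticCurves/Gamma0AwayCharacterExtensionProofs.lean` (the
abelianised Ihara–Serre amalgam `Γ₀(L′; ℤ[1/t]) = Γ₀(L′) *_{Γ₀(tL′)} diag(t,1)⁻¹Γ₀(L′)diag(t,1)`, where
`X₁` = matrices whose top row is `t`-adically larger than the bottom row and `N` = the `t`-adic size).

## References

* R. C. Lyndon, P. E. Schupp, *Combinatorial Group Theory*, Springer (1977); Classics in Mathematics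
  (2001), Ch. III Prop. 12.4, Ch. IV §2 Thm. 2.6. [LyndonSchupp2001]
* J.-P. Serre, *Trees*, Springer (1980), Ch. I §4.1 Thm. 6, Ch. II §1.4 Thm. 3. [SerreTrees1980]
-/

namespace Literature.GroupTheory.CombinatorialGroupTheory

namespace Amalgam

open Monoid Monoid.PushoutI

variable {G : Bool → Type*} [∀ b, Group (G b)] {H : Type*} [Group H] {φ : ∀ b, H →* G b}
  {Δ : Type*} [Group Δ] {β : Type*} [Preorder β]

/-! ### The ping-pong invariant along a reduced word -/

/-- **Ping-pong along a reduced word.**  Under the ping-pong hypotheses (module docstring), for a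
reduced word `l` of the two-factor amalgam with value `x = ψ(g₁ ⋯ gₙ) ∈ Δ`:
(1) if the first letter lies in `G true` then `x ∈ X₁` and `N 1 < N x`;
(2) otherwise `x ∉ X₁` and `N 1 ≤ N x`;
(3) if `N x = N 1` then the word is empty or a single letter `g ∈ G false`, so that `x = ψ(g)` and
`lift f (g₁ ⋯ gₙ) = f false g`.  Induction on the word, the last letter acting first.
[cite: LyndonSchupp2001, Ch. III Prop. 12.4 and Ch. IV Thm. 2.6] -/
theorem pingPong_invariant (ψ : PushoutI φ →* Δ) (X₁ : Set Δ) (N : Δ → β)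
    (h0 : ∀ g : G false, ψ (of false g) ∉ X₁ ∧ N (ψ (of false g)) = N 1)
    (hL : ∀ g : G false, g ∉ (φ false).range → ∀ x ∈ X₁,
      ψ (of false g) * x ∉ X₁ ∧ N (ψ (of false g) * x) = N x)
    (hR : ∀ g : G true, g ∉ (φ true).range → ∀ x ∉ X₁,
      ψ (of true g) * x ∈ X₁ ∧ N x < N (ψ (of true g) * x))
    {M : Type*} [Monoid M] (f : ∀ b, G b →* M) (k : H →* M) (hf : ∀ b, (f b).comp (φ b) = k)
    (l : List (Σ b, G b)) (hc : l.IsChain fun a b => a.1 ≠ b.1)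
    (hr : ∀ y ∈ l, y.2 ∉ (φ y.1).range) :
    (l.head?.map Sigma.fst = some true →
        ψ (l.map fun y => of (φ := φ) y.1 y.2).prod ∈ X₁ ∧
          N 1 < N (ψ (l.map fun y => of (φ := φ) y.1 y.2).prod)) ∧
    (l.head?.map Sigma.fst ≠ some true →
        ψ (l.map fun y => of (φ := φ) y.1 y.2).prod ∉ X₁ ∧
          N 1 ≤ N (ψ (l.map fun y => of (φ := φ) y.1 y.2).prod)) ∧
    (N (ψ (l.map fun y => of (φ := φ) y.1 y.2).prod) = N 1 →
        ∃ g : G false, ψ (of false g) = ψ (l.map fun y => of (φ := φ) y.1 y.2).prod ∧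
          PushoutI.lift f k hf (l.map fun y => of (φ := φ) y.1 y.2).prod = f false g) := by
  induction l with
  | nil =>
    refine ⟨fun h => by simp at h, fun _ => ?_, fun _ => ⟨1, by simp, by simp⟩⟩
    have h01 := h0 1
    rw [map_one, map_one] at h01
    simpa using h01.1
  | cons a l ih =>
    obtain ⟨b, g⟩ := a
    have hc' : l.IsChain fun a b => a.1 ≠ b.1 := List.IsChain.tail hc
    have hr' : ∀ y ∈ l, y.2 ∉ (φ y.1).range := fun y hy => hr y (List.mem_cons_of_mem _ hy)
    have hg : g ∉ (φ b).range := hr ⟨b, g⟩ List.mem_cons_self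
    obtain ⟨ih1, ih2, _⟩ := ih hc' hr'
    -- the head index of the tail differs from `b`
    have hhead : l.head?.map Sigma.fst ≠ some b := by
      cases l with
      | nil => simp
      | cons a' l' =>
        have := List.IsChain.rel hc
        simpa [eq_comm] using this
    simp only [List.map_cons, List.prod_cons, map_mul, List.head?_cons, Option.map_some,
      Option.some.injEq]
    set x := ψ (l.map fun y => of (φ := φ) y.1 y.2).prod with hx
    cases b with
    | false =>
      -- a letter of `G false` off `H`
      refine ⟨fun h => absurd h (by decide), fun _ => ?_, fun hN => ?_⟩
      · by_cases ht : l.head?.map Sigma.fst = some true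
        · obtain ⟨hx1, hN1⟩ := ih1 ht
          obtain ⟨hgx, hNgx⟩ := hL g hg x hx1
          exact ⟨hgx, hNgx ▸ hN1.le⟩
        · -- then the tail is empty
          have hl : l = [] := by
            cases l with
            | nil => rfl
            | cons a' l' =>
              obtain ⟨b', g'⟩ := a'
              cases b' <;> simp_all
          subst hl
          have h0g := h0 g
          simp only [hx, List.map_nil, List.prod_nil, map_one, mul_one]
          exact ⟨h0g.1, h0g.2.ge⟩
      · by_cases ht : l.head?.map Sigma.fst = some true
        · obtain ⟨hx1, hN1⟩ := ih1 ht
          obtain ⟨-, hNgx⟩ := hL g hg x hx1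
          exact absurd (hNgx.symm.trans hN) (ne_of_gt hN1)
        · have hl : l = [] := by
            cases l with
            | nil => rfl
            | cons a' l' =>
              obtain ⟨b', g'⟩ := a'
              cases b' <;> simp_all
          subst hl
          exact ⟨g, by simp [hx], by simp⟩
    | true =>
      -- a letter of `G true` off `H`
      have ht : l.head?.map Sigma.fst ≠ some true := hhead
      obtain ⟨hx1, hN1⟩ := ih2 ht
      obtain ⟨hgx, hNgx⟩ := hR g hg x hx1
      refine ⟨fun _ => ⟨hgx, lt_of_le_of_lt hN1 hNgx⟩, fun h => absurd rfl h, fun hN => ?_⟩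
      exact absurd hN (ne_of_gt (lt_of_le_of_lt hN1 hNgx))

/-! ### The lift kills the kernel of `ψ` -/

/-- **A homomorphism out of the amalgam that is compatible on `H` kills `ker ψ`** when reduced words
act on `Δ` by ping-pong: with (h0), (hL), (hR) as in `pingPong_invariant`, (hB) `H` preserving `X₁` and
the height, and `ψ ∘ of false` injective, every `w` with `ψ w = 1` has `PushoutI.lift f k hf w = 1`.
Proof: `w = c · g₁ ⋯ gₙ` with a reduced word (`exists_reduced_eq`); `N(ψ w) = N 1` forces the word to
be empty or one letter of `G false`, where `lift f` is the homomorphism `f false`.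
[cite: LyndonSchupp2001, Ch. III Prop. 12.4 and Ch. IV Thm. 2.6] -/
theorem lift_eq_one_of_pingPong (hφ : ∀ b, Function.Injective (φ b)) (ψ : PushoutI φ →* Δ)
    (X₁ : Set Δ) (N : Δ → β)
    (h0 : ∀ g : G false, ψ (of false g) ∉ X₁ ∧ N (ψ (of false g)) = N 1)
    (hL : ∀ g : G false, g ∉ (φ false).range → ∀ x ∈ X₁,
      ψ (of false g) * x ∉ X₁ ∧ N (ψ (of false g) * x) = N x)
    (hR : ∀ g : G true, g ∉ (φ true).range → ∀ x ∉ X₁,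
      ψ (of true g) * x ∈ X₁ ∧ N x < N (ψ (of true g) * x))
    (hB : ∀ c : H, ∀ x : Δ, (ψ (base φ c) * x ∈ X₁ ↔ x ∈ X₁) ∧ N (ψ (base φ c) * x) = N x)
    (hinj : ∀ g : G false, ψ (of false g) = 1 → g = 1)
    {M : Type*} [Monoid M] (f : ∀ b, G b →* M) (k : H →* M) (hf : ∀ b, (f b).comp (φ b) = k)
    {w : PushoutI φ} (hw : ψ w = 1) : PushoutI.lift f k hf w = 1 := by
  obtain ⟨c, l, hc, hr, rfl⟩ := exists_reduced_eq hφ w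
  obtain ⟨h1, h2, h3⟩ := pingPong_invariant ψ X₁ N h0 hL hR f k hf l hc hr
  set x := ψ (l.map fun y => of (φ := φ) y.1 y.2).prod with hx
  rw [map_mul] at hw
  -- `N x = N 1`
  have hNx : N x = N 1 := by
    have := (hB c x).2
    rw [hw] at this
    exact this.symm
  obtain ⟨g, hgx, hlift⟩ := h3 hNx
  -- `ψ (base c) * ψ (of g) = 1`, so `φ false c * g = 1`
  have hcg : φ false c * g = 1 := by
    apply hinj
    rw [map_mul, of_apply_eq_base, map_mul, hgx]
    exact hw
  rw [map_mul, hlift, lift_base, ← hf false, MonoidHom.comp_apply, ← map_mul, hcg, map_one]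

/-- **Extension of a compatible pair of homomorphisms along the image of the amalgam** (the form a
consumer extending characters needs).  Under the ping-pong hypotheses of `lift_eq_one_of_pingPong`,
for homomorphisms `f b : G b →* M` to a GROUP `M` agreeing on `H` there is a function `Φ : Δ → M`,
multiplicative on the image `ψ(PushoutI φ)` (= the subgroup of `Δ` generated by the two factors),
with `Φ (ψ (of b g)) = f b g` and `Φ (ψ (base c)) = k c`.  (Values off the image are unconstrained;
`Φ` is `lift f ∘ ψ⁻¹` there.) [cite: SerreTrees1980, Ch. I §4.1 Thm. 6 and Ch. II §1.4 Thm. 3] -/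
theorem exists_extension_of_pingPong (hφ : ∀ b, Function.Injective (φ b)) (ψ : PushoutI φ →* Δ)
    (X₁ : Set Δ) (N : Δ → β)
    (h0 : ∀ g : G false, ψ (of false g) ∉ X₁ ∧ N (ψ (of false g)) = N 1)
    (hL : ∀ g : G false, g ∉ (φ false).range → ∀ x ∈ X₁,
      ψ (of false g) * x ∉ X₁ ∧ N (ψ (of false g) * x) = N x)
    (hR : ∀ g : G true, g ∉ (φ true).range → ∀ x ∉ X₁,
      ψ (of true g) * x ∈ X₁ ∧ N x < N (ψ (of true g) * x))
    (hB : ∀ c : H, ∀ x : Δ, (ψ (base φ c) * x ∈ X₁ ↔ x ∈ X₁) ∧ N (ψ (base φ c) * x) = N x)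
    (hinj : ∀ g : G false, ψ (of false g) = 1 → g = 1)
    {M : Type*} [Group M] (f : ∀ b, G b →* M) (k : H →* M) (hf : ∀ b, (f b).comp (φ b) = k) :
    ∃ Φ : Δ → M, (∀ x ∈ ψ.range, ∀ y ∈ ψ.range, Φ (x * y) = Φ x * Φ y) ∧
      (∀ (b : Bool) (g : G b), Φ (ψ (of b g)) = f b g) ∧ (∀ c : H, Φ (ψ (base φ c)) = k c) := by
  classical
  let L : PushoutI φ →* M := PushoutI.lift f k hf
  let Φ : Δ → M := fun x => if hx : ∃ w : PushoutI φ, ψ w = x then L (Classical.choose hx) else 1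
  have hΦ : ∀ w : PushoutI φ, Φ (ψ w) = L w := by
    intro w
    have hex : ∃ w' : PushoutI φ, ψ w' = ψ w := ⟨w, rfl⟩
    simp only [Φ, dif_pos hex]
    have h1 : ψ (Classical.choose hex) = ψ w := Classical.choose_spec hex
    have h2 : L (Classical.choose hex * w⁻¹) = 1 :=
      lift_eq_one_of_pingPong hφ ψ X₁ N h0 hL hR hB hinj f k hf
        (by rw [map_mul, map_inv, h1, mul_inv_cancel])
    rwa [map_mul, map_inv, mul_inv_eq_one] at h2
  refine ⟨Φ, ?_, ?_, ?_⟩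
  · rintro _ ⟨w, rfl⟩ _ ⟨w', rfl⟩
    rw [← map_mul, hΦ, hΦ, hΦ, map_mul]
  · intro b g
    rw [hΦ]
    exact lift_of f k hf g
  · intro c
    rw [hΦ]
    exact lift_base f k hf c

end Amalgam

end Literature.GroupTheory.CombinatorialGroupTheory
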